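import Mathlib
import HarnessLib
import Summits.CriticalPhenomena.CardyFormulaZ2.Theses.CardyComplexCone
import Literature.Probability.LatticeModels.ExplorationWinding
import Literature.Probability.LatticeModels.MedialWindingBridge

/-!
# Vocabulary of line `Sketch` (one-cut composition `FixedRadiusCut`) for crux `EdgeCoherence` (stmt-CriticalPhenomena-11385)

Route `CardyComplexCone` (sub-problem `CriticalPhenomena/CardyFormulaZ2`), crux
`Summit.CriticalPhenomena.CardyFormulaZ2.Theses.CardyComplexCone.EdgeCoherence` (item stmt-CriticalPhenomena-11385).
This file is the **definitions module** of the checked skeleton `Cruxes/EdgeCoherence/Lines/Sketch.lean` (lead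
`prover-line-stmt-CriticalPhenomena-11385-0`, `ledger skeleton check` OK, six registered stubs `stub_aliasing`,
`stub_oneCut`, `stub_factorisation`, `stub_envelope`, `stub_remainder`, `stub_innerCoherence`). It carries,
sorry-free, the skeleton's VOCABULARY — the corner observable `cornerObs` (verbatim the crux integrand, bridge
`edgeCoherence_iff_cornerObs : EdgeCoherence ↔ … := Iff.rfl`), its `ℤ₄`-harmonics `harmonic`, the lattice ball
`InBall`, the quenched inner configuration `mixCfg`, the orbit phase `orbitPhase`, the δ-FREE inner response tensor
`innerResp` / `innerHarmonic` of the card `fixed-radius-equivariant-cut`, the explicit one-cut objects `startCorner`,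
`entryTime`, `FirstExcursion`, `cutEdgesAt`, `entryLabel`, `entryWeight`, `remainderObs`, the milestones
`HarmonicVanishing`, `InnerUniformCoherence`, `OneCutPresentation` and the six stub STATEMENTS `Sig.stub_*`
(each a `def … : Prop` to be PROVED by a helper file `Theorems/CardyComplexConeEdgeCoherence<Stub>.lean`,
`--supports stmt-CriticalPhenomena-11385`; nothing is asserted here) — so that the helper files and the closing
skeleton share ONE copy of every object. The one theorem besides the `Iff.rfl` bridge is the pure-logic glue
`oneCutPresentation_of : Sig.stub_factorisation → Sig.stub_envelope → Sig.stub_remainder → OneCutPresentation`.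

Kept in its own file (not appended to `CardyComplexConeDefs.lean`): the inner tensor needs `cornerOrbit` /
`turnSign` (`ExplorationWinding`, whose closure contains `FermionicObservable`); importing that into
`CardyComplexConeDefs.lean` would re-resolve the bare name `LatticeModels.winding` there from the alias
`Polyline.winding` (the route file's reading) to the genuine constant of `FermionicObservable` and silently break
the definitional bridges of the two vocabularies already in that file; here `Polyline.winding` is written
explicitly. Also the 400-line cap.

Typing decisions (lead, `Cruxes/EdgeCoherence/PICKED.md`): faces by the tree's `faceAt v k`; `innerResp` over the
finite horizon `hitBound ρ` (not a `tsum`); CENTRED labels with the support clause `¬ InBall ρ l.2.1` inside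
`OneCutPresentation` (triage r1-2 defect (2)); `InnerUniformCoherence` in the card's sup/sup fallback packaging
(witness form) with the matching mass × sup-signal envelope (triage r1-2 sharpen (4)).

Sources: H. Duminil-Copin, S. Smirnov, *Conformal invariance of lattice models*, Clay Math. Proc. 15 (2012) §8
(Conj. 8.7, the `q = 1`, spin-`1/3` observable); S. Smirnov, Ann. of Math. 172 (2010) §2.2; idea cards
`Cruxes/EdgeCoherence/Ideas/{spin-aliasing-vertex-mode, fixed-radius-equivariant-cut}.md`.
-/

noncomputable section

namespace Summit.CriticalPhenomena.CardyFormulaZ2.Cruxes.EdgeCoherence.FixedRadiusCut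

open scoped BigOperators Topology
open Filter Set MeasureTheory
open Literature.Probability.LatticeModels Literature.Probability.RandomPlanarGeometry
open Literature.Probability.Percolation (BondConfig bondPercolation half)
open Summit.CriticalPhenomena.CardyFormulaZ2.Theses.CardyComplexCone (EdgeCoherence)

/-! ### Vocabulary, I: the corner observable and its `ℤ₄`-harmonics -/

/-- The spin-`1/3` CORNER OBSERVABLE of the medial exploration path of the discrete Dobrushin data `E`,
read at mesh `δ`, at the corner `(v, f)` — VERBATIM the `let E := …` integrand of the crux with `Λ δ ↦ E`
(so `E δ v f` there is definitionally `cornerObs (Λ δ) δ v f`: `edgeCoherence_iff_cornerObs` is `Iff.rfl`).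
NAME-RESOLUTION CAVEAT: the route file sees only the ALIAS `LatticeModels.winding → Polyline.winding`
(export of `MedialWinding`), whereas this file's import closure (`ExplorationWinding → MedialInterfaceProofs →
FermionicObservable`) also contains the genuine constant `LatticeModels.winding` (equal as a function,
`Polyline.winding_eq_winding`, but NOT definitionally), which wins the bare name; so the polyline winding is
written `Polyline.winding` explicitly here and in every stub file. -/
def cornerObs (E : DiscreteDobrushin) (δ : ℝ) (v f : Site 2) : ℂ :=
  ∫ ω, (let γ := Literature.Probability.LatticeModels.medialExploration E ω;
    ∑ k ∈ (Finset.range γ.length).filter (fun k => γ[k]? = some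
      (Literature.Probability.LatticeModels.cornerSource v f) ∧ γ[k + 1]? = some
      (Literature.Probability.LatticeModels.cornerTarget v f)), Complex.exp (-(Complex.I / 3) *
      ((Literature.Probability.LatticeModels.Polyline.winding ((γ.map
      (Literature.Probability.LatticeModels.medialPoint δ)).take (k + 2)) : ℝ) : ℂ)))
    ∂(bondPercolation (zdGraph 2) half)

/-- The `k`-th `ℤ₄`-HARMONIC of the class vector at `v`: `H_k(v) = Σ_{c : Fin 4} i^{kc} E_δ(v, faceAt v c)`
(faces counter-clockwise `v, v−e₀, v−e₀−e₁, v−e₁` = travel classes NW, SW, SE, NE). `H₀` is the spin-`1/3`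
site mode; `H₁, H₂, H₃` are the spin-`2/3, 5/3, 4/3` aliases. -/
def harmonic (Λ : ℝ → DiscreteDobrushin) (δ : ℝ) (k : ℕ) (v : Site 2) : ℂ :=
  ∑ c : Fin 4, Complex.I ^ (k * (c : ℕ)) * cornerObs (Λ δ) δ v (faceAt v c)

/-- **HarmonicVanishing** (card `spin-aliasing-vertex-mode`, the transfer target): in every Dobrushin domain
and every discretisation family the three non-trivial harmonics are `o(δ^{1/3})` locally uniformly.
Equivalent (finite Fourier inversion) to `EdgeCoherence` with `u ≡ 1`. -/
def HarmonicVanishing : Prop :=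
  ∀ (D : DobrushinDomain) (Λ : ℝ → DiscreteDobrushin), (∀ δ, (Λ δ).Ω = D.carrier) →
    (∀ δ, (Λ δ).δ = δ) → (∀ᶠ δ in 𝓝[>] (0:ℝ), (Λ δ).IsZdAdmissible) →
    ∀ K : Set ℂ, IsCompact K → K ⊆ D.carrier → ∀ ε > (0:ℝ), ∀ᶠ δ in 𝓝[>] (0:ℝ),
      ∀ v : Site 2, meshPoint δ v ∈ K → ∀ k ∈ ({1, 2, 3} : Finset ℕ),
        ‖harmonic Λ δ k v‖ ≤ ε * δ ^ ((1:ℝ) / 3)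

/-- **Certificate (definitional): the crux read over `cornerObs`.** `EdgeCoherence` is, by `Iff.rfl`, the
statement below with `E δ v f` replaced by `cornerObs (Λ δ) δ v f` (for the prover of `stub_aliasing`). -/
theorem edgeCoherence_iff_cornerObs :
    EdgeCoherence ↔
      ∃ u : Site 2 → ℂ, (∃ o : Site 2, IsCorner 0 o ∧ u o ≠ 0) ∧
        ∀ (D : DobrushinDomain) (Λ : ℝ → DiscreteDobrushin), (∀ δ, (Λ δ).Ω = D.carrier) →
          (∀ δ, (Λ δ).δ = δ) → (∀ᶠ δ in 𝓝[>] (0:ℝ), (Λ δ).IsZdAdmissible) →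
            ∀ K : Set ℂ, IsCompact K → K ⊆ D.carrier → ∀ ε > (0:ℝ), ∀ᶠ δ in 𝓝[>] (0:ℝ),
              ∀ v f f' : Site 2, IsCorner v f → IsCorner v f' → meshPoint δ v ∈ K →
                ‖u (f' - v) * cornerObs (Λ δ) δ v f - u (f - v) * cornerObs (Λ δ) δ v f'‖ ≤
                  ε * δ ^ ((1:ℝ) / 3) := by
  -- No longer `Iff.rfl`: the route decl `EdgeCoherence` spells FermionicObservable's
  -- `Literature.Probability.LatticeModels.winding`, while `cornerObs` spells `Polyline.winding`; the two
  -- windings agree propositionally (`Polyline.winding_eq_winding'`, structural induction), not by `rfl`.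
  simp only [cornerObs, Literature.Probability.LatticeModels.Polyline.winding_eq_winding']
  exact Iff.rfl

/-! ### Vocabulary, II: the δ-free inner response tensor of the lattice ball -/

/-- The closed lattice ball of radius `ρ` about the origin (squared Euclidean form). -/
def InBall (ρ : ℕ) (x : Site 2) : Prop := x 0 ^ 2 + x 1 ^ 2 ≤ (ρ : ℤ) ^ 2

/-- The QUENCHED inner configuration of the ball: inner–inner edges (both endpoints in the ball) are read
from `ω`, every other edge is frozen to the boundary condition `β`. -/
def mixCfg (ρ : ℕ) (β ω : BondConfig (Site 2)) : BondConfig (Site 2) :=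
  {e | (e ∈ ω ∧ ∀ x ∈ e, InBall ρ x) ∨ (e ∈ β ∧ ∃ x ∈ e, ¬ InBall ρ x)}

/-- The phase of the `k`-th dart of the medial orbit of `β'` from `c₀`:
`exp(−(i/3)·(π/2)·S_k)`, `S_k = Σ_{i<k} turnSign` (left turns `+1`, right turns `−1`) — the shape of
`Negative.dartPhaseSum_eq_exp_turnSign`. -/
def orbitPhase (β' : BondConfig (Site 2)) (c₀ : Site 2 × Fin 4) (k : ℕ) : ℂ :=
  Complex.exp (-(Complex.I / 3) * ((Real.pi / 2 *
    ∑ i ∈ Finset.range k, (turnSign β' (cornerOrbit β' c₀ i) : ℝ) : ℝ) : ℂ))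

/-- `InnerHit ρ β' e c n`: the orbit of `β'` from the corner `e` is at the centre corner `(0, c)` at time
`n`, having stayed inside the ball at all times `1, …, n`. -/
def InnerHit (ρ : ℕ) (β' : BondConfig (Site 2)) (e : Site 2 × Fin 4) (c : Fin 4) (n : ℕ) : Prop :=
  cornerOrbit β' e n = (0, c) ∧ ∀ m, 0 < m → m ≤ n → InBall ρ (cornerOrbit β' e m).1

/-- Time horizon of the inner tensor: an orbit entering from outside visits pairwise distinct corners while
inside (`nextCorner_injective`), and the ball has `≤ (2ρ+1)²` sites, so `InnerHit … n` forces
`n < hitBound ρ`. -/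
def hitBound (ρ : ℕ) : ℕ := 4 * (2 * ρ + 1) ^ 2 + 1

open scoped Classical in
/-- **The δ-free inner response tensor** `T_ρ(β; e, c)` of the lattice ball `B_ρ` with frozen boundary
condition `β`: the expectation, over the inner–inner edges only, of the phase of the orbit from the entry
corner `e` on the event that it reaches the centre corner `(0,c)` inside the ball. -/
def innerResp (ρ : ℕ) (β : BondConfig (Site 2)) (e : Site 2 × Fin 4) (c : Fin 4) : ℂ :=
  ∫ ω, (∑ n ∈ Finset.range (hitBound ρ),
      if InnerHit ρ (mixCfg ρ β ω) e c n then orbitPhase (mixCfg ρ β ω) e n else 0)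
    ∂(bondPercolation (zdGraph 2) half)

/-- The `k`-th `ℤ₄`-harmonic (in the centre class) of the inner response: `T̂_ρ(β; e, k) = Σ_c i^{kc} T_ρ(β;e,c)`;
`k = 0` is the inner SIGNAL, `k = 1,2,3` are the inner ALIASES. -/
def innerHarmonic (ρ : ℕ) (β : BondConfig (Site 2)) (e : Site 2 × Fin 4) (k : ℕ) : ℂ :=
  ∑ c : Fin 4, Complex.I ^ (k * (c : ℕ)) * innerResp ρ β e c

/-- **InnerUniformCoherence** — the δ-free transfer target `C⁺` in sup/sup (witness) packaging: for
`k = 1,2,3` and `ε > 0`, for all large `ρ`, the inner alias harmonic of EVERY label `(β, e)` with entry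
vertex outside the ball is at most `ε` times the inner signal harmonic of SOME such label. -/
def InnerUniformCoherence : Prop :=
  ∀ k ∈ ({1, 2, 3} : Finset ℕ), ∀ ε > (0:ℝ), ∀ᶠ ρ : ℕ in atTop,
    ∀ (β : BondConfig (Site 2)) (e : Site 2 × Fin 4), ¬ InBall ρ e.1 →
      ∃ (β' : BondConfig (Site 2)) (e' : Site 2 × Fin 4), ¬ InBall ρ e'.1 ∧
        ‖innerHarmonic ρ β e k‖ ≤ ε * ‖innerHarmonic ρ β' e' 0‖

/-- **OneCutPresentation** (abstract form consumed by `stub_oneCut`): for every domain, family and compact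
there are `C` (uniform in `ρ`!) and a null sequence `η` such that for every `ρ`, eventually in `δ`, at every
vertex `v` over `K` the class vector is PRESENTED through the inner tensor by finitely supported CENTRED
labels with entry vertex outside the ball: (i) `E_δ(v, faceAt v c) = Σ_l A(l)·T_ρ(l.1; l.2, c) + r(c)`;
(ii') mass × sup-signal envelope `(Σ_l ‖A l‖)·‖T̂_ρ(β;e,0)‖ ≤ C δ^{1/3}` for every label `(β,e)`;
(iii) remainder aliases `‖r̂_k‖ ≤ η(ρ) δ^{1/3}`. Supplied by `stub_factorisation ∧ stub_envelope ∧
stub_remainder` with the explicit `entryWeight` / `remainderObs` (`oneCutPresentation_of`). -/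
def OneCutPresentation : Prop :=
  ∀ (D : DobrushinDomain) (Λ : ℝ → DiscreteDobrushin), (∀ δ, (Λ δ).Ω = D.carrier) →
    (∀ δ, (Λ δ).δ = δ) → (∀ᶠ δ in 𝓝[>] (0:ℝ), (Λ δ).IsZdAdmissible) →
    ∀ K : Set ℂ, IsCompact K → K ⊆ D.carrier →
      ∃ C : ℝ, ∃ η : ℕ → ℝ, Tendsto η atTop (𝓝 0) ∧ ∀ ρ : ℕ, ∀ᶠ δ in 𝓝[>] (0:ℝ),
        ∀ v : Site 2, meshPoint δ v ∈ K →
          ∃ (A : BondConfig (Site 2) × (Site 2 × Fin 4) → ℂ) (r : Fin 4 → ℂ),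
            A.support.Finite ∧ (∀ l ∈ A.support, ¬ InBall ρ l.2.1) ∧
            (∀ c : Fin 4, cornerObs (Λ δ) δ v (faceAt v c) =
              (∑ᶠ l, A l * innerResp ρ l.1 l.2 c) + r c) ∧
            (∀ (β : BondConfig (Site 2)) (e : Site 2 × Fin 4), ¬ InBall ρ e.1 →
              (∑ᶠ l, ‖A l‖) * ‖innerHarmonic ρ β e 0‖ ≤ C * δ ^ ((1:ℝ) / 3)) ∧
            ∀ k ∈ ({1, 2, 3} : Finset ℕ),
              ‖∑ c : Fin 4, Complex.I ^ (k * (c : ℕ)) * r c‖ ≤ η ρ * δ ^ ((1:ℝ) / 3)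

/-! ### Vocabulary, III: the explicit cut — first entry, labels, outer weights, remainder -/

/-- The start corner of the exploration of `E` (the unique one for admissible data,
`existsUnique_startCorner`; junk otherwise). -/
def startCorner (E : DiscreteDobrushin) : Site 2 × Fin 4 :=
  Classical.epsilon fun c => E.IsStartCorner c

/-- The FIRST ENTRY TIME into the ball `B(v,ρ)` of a corner sequence `o`: the least `t` such that the vertex
of `o (t+1)` lies in the ball (`o t` is then the entry corner, outside when `o 0` is). Junk `0` if the
sequence never enters (then `o 1` is not in the ball, which every use below excludes). -/
def entryTime (ρ : ℕ) (v : Site 2) (o : ℕ → Site 2 × Fin 4) : ℕ :=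
  sInf {t | InBall ρ ((o (t + 1)).1 - v)}

/-- `FirstExcursion ρ v o k`: time `k` lies on the first excursion of `o` inside `B(v,ρ)` — after the first
entry time and with the sequence inside the ball at all times in `(entryTime, k]`. -/
def FirstExcursion (ρ : ℕ) (v : Site 2) (o : ℕ → Site 2 × Fin 4) (k : ℕ) : Prop :=
  entryTime ρ v o < k ∧ ∀ m, entryTime ρ v o < m → m ≤ k → InBall ρ ((o m).1 - v)

/-- The edges CROSSING the cut circle of `B(v,ρ)`: one endpoint inside, one outside. -/
def cutEdgesAt (ρ : ℕ) (v : Site 2) : Set (Sym2 (Site 2)) :=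
  {e | (∃ x ∈ e, InBall ρ (x - v)) ∧ ∃ y ∈ e, ¬ InBall ρ (y - v)}

/-- The CENTRED LABEL of a configuration `β'` with orbit `o` at the ball `B(v,ρ)`: the frozen cut-crossing
pattern translated by `−v`, and the entry corner translated by `−v`. -/
def entryLabel (ρ : ℕ) (v : Site 2) (β' : BondConfig (Site 2)) (o : ℕ → Site 2 × Fin 4) :
    BondConfig (Site 2) × (Site 2 × Fin 4) :=
  ((fun e : Sym2 (Site 2) => e.map fun x => x - v) '' (β' ∩ cutEdgesAt ρ v),
    ((o (entryTime ρ v o)).1 - v, (o (entryTime ρ v o)).2))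

open scoped Classical in
/-- **The explicit OUTER WEIGHT** `A(l)` of the centred label `l` at the ball `B(v,ρ)` for the datum `E`:
the expectation of the orbit phase AT the first entry, on the event that the exploration enters the ball
before its end with label `l` (the stopped exploration: a function of the edges that are not inner–inner). -/
def entryWeight (ρ : ℕ) (E : DiscreteDobrushin) (v : Site 2)
    (l : BondConfig (Site 2) × (Site 2 × Fin 4)) : ℂ :=
  ∫ ω, (let β' := E.bcBondConfig ω
    let o := cornerOrbit β' (startCorner E)
    if InBall ρ ((o (entryTime ρ v o + 1)).1 - v) ∧
        entryTime ρ v o + 1 < (medialExploration E ω).length ∧ entryLabel ρ v β' o = l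
    then orbitPhase β' (startCorner E) (entryTime ρ v o) else 0)
    ∂(bondPercolation (zdGraph 2) half)

open scoped Classical in
/-- **The explicit REMAINDER** `r(c)` at the ball `B(v,ρ)`: the expected phase sum over the passages of the
exploration along the dart `(v, faceAt v c)` that are NOT on the first excursion into the ball (passages
after a re-entry). -/
def remainderObs (ρ : ℕ) (E : DiscreteDobrushin) (v : Site 2) (c : Fin 4) : ℂ :=
  ∫ ω, (let β' := E.bcBondConfig ω
    let o := cornerOrbit β' (startCorner E)
    ∑ k ∈ Finset.range ((medialExploration E ω).length - 1),
      if o k = (v, c) ∧ ¬ FirstExcursion ρ v o k then orbitPhase β' (startCorner E) k else 0)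
    ∂(bondPercolation (zdGraph 2) half)

/-! ### The six stub statements

Each stub's statement is the `Prop` `Sig.stub_<name>`; the registered obligation (skeleton
`Cruxes/EdgeCoherence/Lines/Sketch.lean`) is `theorem stub_<name> : Sig.stub_<name>`, to be proved in
`Theorems/CardyComplexConeEdgeCoherence<Stub>.lean` (`--supports stmt-CriticalPhenomena-11385`); the skeleton's
composition `EdgeCoherence_of` takes the six statements as hypotheses BY NAME. Nothing here is asserted. -/

/-- STUB 1 statement — **ALIASING** (first lemma of card `spin-aliasing-vertex-mode`; provable now, M):
`HarmonicVanishing → EdgeCoherence` with `u ≡ 1`: every face cornered at `v` is `faceAt v c`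
(`exists_faceAt_of_isCorner`), `4(E_a − E_b) = Σ_{k=1}^{3} (i^{−ka} − i^{−kb}) H_k` (finite Fourier
inversion), so `‖E_a − E_b‖ ≤ ½(‖H₁‖ + ‖H₂‖ + ‖H₃‖) ≤ (3/2)·ε'·δ^{1/3}`. -/
def Sig.stub_aliasing : Prop := HarmonicVanishing → EdgeCoherence

/-- STUB 2 statement — **ONE CUT** (first lemma of card `fixed-radius-equivariant-cut`; provable now, M):
`OneCutPresentation → InnerUniformCoherence → HarmonicVanishing`. Given `D, Λ, K, ε`: take `C, η` from the
presentation; by `Tendsto η` and the inner coherence (with `ε₁ = ε / (2(|C|+1))`, `k = 1,2,3`) FIX one large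
`ρ` with `|η ρ| ≤ ε/2` and the sup/sup bound; then eventually in `δ`, at `v` over `K`:
`H_k(v) = Σᶠ_l A l · T̂(l,k) + r̂_k` (linearity in `c`),
`‖Σᶠ_l A l T̂(l,k)‖ ≤ Σ_l ‖A l‖ ‖T̂(l,k)‖ ≤ ε₁ Σ_l ‖A l‖ ‖T̂(l'_l,0)‖ ≤ ε₁ (Σ_l ‖A l‖) max_l ‖T̂(l'_l,0)‖ ≤ ε₁ C δ^{1/3}`
(the witnesses `l'_l` have entry vertex outside the ball, so (ii') applies to the maximiser), plus
`‖r̂_k‖ ≤ (ε/2) δ^{1/3}`. -/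
def Sig.stub_oneCut : Prop := OneCutPresentation → InnerUniformCoherence → HarmonicVanishing

/-- STUB 3 statement — **EXACT FIRST-ENTRY FACTORISATION** (provable now, L): for every domain, family
(guards), compact `K ⊂ D` and radius `ρ`, eventually in `δ`, at every `v` with `δv ∈ K`, the explicit outer
weight `entryWeight ρ (Λ δ) v` is finitely supported on labels with entry vertex outside the ball and
`E_δ(v, faceAt v c) = Σᶠ_l entryWeight l · innerResp ρ l.1 l.2 c + remainderObs ρ (Λ δ) v c` for all `c`.
Ingredients: orbit form of the integrand (`Negative.mem_dartFilter_iff`, `dartPhaseSum_eq_exp_turnSign`,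
`δ > 0`), phase additivity along the orbit, the ball `B(v,ρ)` at lattice distance `≥ 3` from `zdBoundary`
eventually (so `bcBondConfig ω = ω` on every edge touching the ball, the start corner and the exit are
outside, the inner orbit from the entry corner under `bcBondConfig ω` IS `cornerOrbit (mixCfg ρ β̃ (ω − v)) ẽ`
while inside), independence of the inner–inner edges from all other edges under `setBer` and translation
invariance by `v`. -/
def Sig.stub_factorisation : Prop :=
  ∀ (D : DobrushinDomain) (Λ : ℝ → DiscreteDobrushin), (∀ δ, (Λ δ).Ω = D.carrier) →
    (∀ δ, (Λ δ).δ = δ) → (∀ᶠ δ in 𝓝[>] (0:ℝ), (Λ δ).IsZdAdmissible) →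
    ∀ K : Set ℂ, IsCompact K → K ⊆ D.carrier → ∀ ρ : ℕ, ∀ᶠ δ in 𝓝[>] (0:ℝ),
      ∀ v : Site 2, meshPoint δ v ∈ K →
        (entryWeight ρ (Λ δ) v).support.Finite ∧
        (∀ l ∈ (entryWeight ρ (Λ δ) v).support, ¬ InBall ρ l.2.1) ∧
        ∀ c : Fin 4, cornerObs (Λ δ) δ v (faceAt v c) =
          (∑ᶠ l, entryWeight ρ (Λ δ) v l * innerResp ρ l.1 l.2 c) + remainderObs ρ (Λ δ) v c

/-- STUB 4 statement — **OUTER ABSOLUTE ENVELOPE** (OPEN; crux-#3 / `EdgePrecompact` (i) in factorised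
form): one constant `C` per `(D, Λ, K)`, uniform in `ρ`, with `(Σ_l ‖entryWeight l‖)·‖T̂_ρ(β; e, 0)‖ ≤ C δ^{1/3}`
for every label `(β, e)` with entry vertex outside the ball, eventually in `δ`. Heuristic (Coulomb gas):
`Σ‖A‖ ≍ P(γ enters B(v,ρδ))·(ρδ)^{1/12} ≍ (ρδ)^{1/3}`, `sup ‖T̂₀‖ ≍ ρ^{−1/4−1/12}`. -/
def Sig.stub_envelope : Prop :=
  ∀ (D : DobrushinDomain) (Λ : ℝ → DiscreteDobrushin), (∀ δ, (Λ δ).Ω = D.carrier) →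
    (∀ δ, (Λ δ).δ = δ) → (∀ᶠ δ in 𝓝[>] (0:ℝ), (Λ δ).IsZdAdmissible) →
    ∀ K : Set ℂ, IsCompact K → K ⊆ D.carrier → ∃ C : ℝ, ∀ ρ : ℕ, ∀ᶠ δ in 𝓝[>] (0:ℝ),
      ∀ v : Site 2, meshPoint δ v ∈ K →
        ∀ (β : BondConfig (Site 2)) (e : Site 2 × Fin 4), ¬ InBall ρ e.1 →
          (∑ᶠ l, ‖entryWeight ρ (Λ δ) v l‖) * ‖innerHarmonic ρ β e 0‖ ≤ C * δ ^ ((1:ℝ) / 3)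

/-- STUB 5 statement — **RE-ENTRY REMAINDER** (OPEN): a null sequence `η` per `(D, Λ, K)` such that the alias
harmonics of the remainder are `≤ η(ρ) δ^{1/3}` eventually in `δ` (re-entry passages are a `ρ`-independent
fraction of the mass; their aliases need the same inner suppression — the card's `DecoratedInnerCoherence` +
`ReentryTail`). -/
def Sig.stub_remainder : Prop :=
  ∀ (D : DobrushinDomain) (Λ : ℝ → DiscreteDobrushin), (∀ δ, (Λ δ).Ω = D.carrier) →
    (∀ δ, (Λ δ).δ = δ) → (∀ᶠ δ in 𝓝[>] (0:ℝ), (Λ δ).IsZdAdmissible) →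
    ∀ K : Set ℂ, IsCompact K → K ⊆ D.carrier → ∃ η : ℕ → ℝ, Tendsto η atTop (𝓝 0) ∧
      ∀ ρ : ℕ, ∀ᶠ δ in 𝓝[>] (0:ℝ), ∀ v : Site 2, meshPoint δ v ∈ K →
        ∀ k ∈ ({1, 2, 3} : Finset ℕ),
          ‖∑ c : Fin 4, Complex.I ^ (k * (c : ℕ)) * remainderObs ρ (Λ δ) v c‖ ≤ η ρ * δ ^ ((1:ℝ) / 3)

/-- STUB 6 statement — **INNER UNIFORM COHERENCE** (OPEN, δ-free; the load-bearing bet, held by the lead). -/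
def Sig.stub_innerCoherence : Prop := InnerUniformCoherence

/-! ### Glue (proved): the explicit cut supplies the abstract presentation -/

/-- The three explicit statements give `OneCutPresentation` (pure filter logic: intersect the three
eventualities at each `ρ` and take `A := entryWeight ρ (Λ δ) v`, `r := remainderObs ρ (Λ δ) v`). -/
theorem oneCutPresentation_of :
    Sig.stub_factorisation → Sig.stub_envelope → Sig.stub_remainder → OneCutPresentation := by
  intro hF hE hR D Λ hΩ hδ hadm K hK hKD
  obtain ⟨C, hC⟩ := hE D Λ hΩ hδ hadm K hK hKD
  obtain ⟨η, hη, hr⟩ := hR D Λ hΩ hδ hadm K hK hKD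
  refine ⟨C, η, hη, fun ρ => ?_⟩
  filter_upwards [hF D Λ hΩ hδ hadm K hK hKD ρ, hC ρ, hr ρ] with δ h1 h2 h3 v hv
  obtain ⟨hfin, hout, hpres⟩ := h1 v hv
  exact ⟨entryWeight ρ (Λ δ) v, remainderObs ρ (Λ δ) v, hfin, hout, hpres, h2 v hv, h3 v hv⟩

end Summit.CriticalPhenomena.CardyFormulaZ2.Cruxes.EdgeCoherence.FixedRadiusCut

end
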